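import Summits.BirchSwinnertonDyer.BirchSwinnertonDyer.Theorems.AdditiveKolyvaginRoadLevelSystemsCoreConnected
import Summits.BirchSwinnertonDyer.BirchSwinnertonDyer.Theorems.AdditiveKolyvaginRoadKolyvaginPrimitiveAdditiveParityOfLevelInputs
import Summits.BirchSwinnertonDyer.BirchSwinnertonDyer.Theorems.AdditiveKolyvaginRoadEigen
import Summits.BirchSwinnertonDyer.BirchSwinnertonDyer.Theses.AdditiveKolyvaginRoad
import HarnessLib

/-!
# Route `AdditiveKolyvaginRoad`, crux `LevelKolyvaginSystemsAdditive` (item stmt-BirchSwinnertonDyer-21396, KS′):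
# KS′'s conclusion at a ♯ frame from a bipartite datum and ONE seed, granted the route's PUBLISHED inputs — the
# parity binder of the rigidity chain DISCHARGED (Gross–Zagier + Kolyvagin + Cassels–Tate ⟹ odd `dim Sel_p(E/K)`)
# (cell `pub/bsd-wall`, width seat `bsd-wall-akr-p2x-w2` g2; `--supports stmt-BirchSwinnertonDyer-21396`, helper; part 6 of the
# rigidity chain `…RigidityCore` ∕ `…Rigidity` ∕ `…OfIgnition` ∕ `…RigidityDichotomy` ∕ `…RigidityConnected` ∕ `…CoreConnected`)

WHAT. Part 5's `nonempty_levelKolyvaginSystemP_of_bipartite_of_seed_at_frame` gives `Nonempty (LevelKolyvaginSystemP …)`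
at a ♯ additive frame from a bipartite datum (even-level classes, odd-level values, Bertolini–Darmon laws two-sided),
`selmer_bottom`, ONE SEED at a core level, the witness-free one-prime RAISING (R′) and ODD total canonical rank at the bottom
level. The last binder is the `p`-PARITY of `Sel_p(E/K)` at an `r_an = 1` frame — akr-p1's `oddSelmerRankAdditive_of_levelInputs`
(Gross–Zagier: `y_K` non-torsion; Kolyvagin: rank one and `Ш` finite; `E(K)[p] = 0` from `ρ̄` onto; Cassels–Tate: `dim Ш[p]`
even — all from the route's displayed PUBLISHED inputs `PublishedInputsAdditiveKoly` ∕ `PublishedDualityInputsAdditiveKoly`),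
converted to the `SelQP ∅` currency by `natCard_selmer_eq_pow_finrank_selQP_add` (akr-p1). THIS FILE:
* `odd_finrank_selQP_empty_of_published` — at every ♯ additive frame, `dim Sel_∅⁺ + dim Sel_∅⁻` is ODD, granted PUB ∕ DUAL;
* `nonempty_levelKolyvaginSystemP_of_bipartite_of_seed_of_published` — KS′'s conclusion at a ♯ frame ⟸ PUB ∧ DUAL (by name)
  ∧ bipartite datum ∧ `selmer_bottom` ∧ ONE seed at a core level ∧ (R′). What KS′ asks beyond the E-side is thus: the
  bipartite system at `p²`-level (K1 + two-sided BD laws) and ONE seed; the E-side residual is (R′) alone (W. Zhang Lemma 5.3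
  raising half with the sign pinned by (Equiv); the tree's (R) `selQP_raise_of_admQ` is it modulo Poitou–Tate = DUAL.2 plus a
  Kummer witness — a witness-free proof needs ONE local fact: the Kummer line and the toric line of `H¹(K_v, E[p])` are
  distinct, Bertolini–Darmon Lemma 2.6 locally).

HONEST FRAMING: theorems only; 0 definitions, 0 named facts, 0 `sorry`; CONDITIONAL on the displayed PUB ∕ DUAL named facts,
the bipartite datum, the seed and (R′); closes nothing. BSD is not proved by any of this.

References: [cite: Howard2006Bipartite, Prop. 2.4.11, Thm. 2.5.1] [cite: WZhang2014, Lemma 5.3, Prop. 5.4, Thm. 7.2, Thm. 9.2,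
§9] [cite: GrossLMS1991, §10 (Prop. 2.3)] [cite: BertoliniDarmon2005, Thm. 4.1, Thm. 4.2].
-/

-- single-conjunct summit: `Summit.BirchSwinnertonDyer.BirchSwinnertonDyer.…` repeats the name by design
set_option linter.dupNamespace false

noncomputable section

open scoped Classical

namespace Summit.BirchSwinnertonDyer.BirchSwinnertonDyer.Theorems.AdditiveKoly

open WeierstrassCurve NumberField IsDedekindDomain
  Literature.NumberTheory.EllipticCurves Literature.NumberTheory.EllipticCurves.ModularForms
  Literature.NumberTheory.EllipticCurves.Rank1Residual Literature.NumberTheory.GaloisRepresentations Module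
  Summit.BirchSwinnertonDyer.Rank1Residual.X11b.Three.Koly
  Summit.BirchSwinnertonDyer.BirchSwinnertonDyer.Theses.AdditiveKolyvaginRoad

variable (W : WeierstrassCurve ℚ) (K : Type) [Field K] [NumberField K] (p : ℕ) [W.IsElliptic] [W.IsGloballyMinimal]
  [NeZero (W.conductorNorm ℤ)] [Fact p.Prime] (c : K ≃ₐ[ℚ] K) [Module (ZMod p) (Vp W K p)]
  (Dt : ModularParametrizationData W (W.conductorNorm ℤ)) (β : ℤ) (ι : K →+* ℂ)

/-! ## §1 The parity binder from the published inputs -/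

include Dt β ι in
/-- **ODD total canonical rank at the bottom level, from the PUBLISHED inputs** (the `hodd` binder of parts 4–5): at a ♯
additive frame (`p ≥ 5`, `Addv W p`, `ρ̄` onto, ♠, `p ∤ ∏ c`, `r_an = 1`, `K` imaginary quadratic with odd `d_K`, Heegner for
`N_E`, `L(E^{d_K}, 1) ≠ 0`, `4N ∣ β² − d_K`, `p ∤ c_Manin`), granted `PublishedInputsAdditiveKoly` (Gross–Zagier, Kolyvagin,
modularity) and `PublishedDualityInputsAdditiveKoly` (levelwise Cassels–Tate): `dim Sel_∅⁺ + dim Sel_∅⁻` is odd — akr-p1's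
`oddSelmerRankAdditive_of_levelInputs` (`#Sel_p(E/K) = p^s`, `s` odd) read through `natCard_selmer_eq_pow_finrank_selQP_add`.
[cite: WZhang2014, Thm. 9.2] [cite: GrossLMS1991, §10 (Prop. 2.3)] -/
theorem odd_finrank_selQP_empty_of_published (hPUB : PublishedInputsAdditiveKoly) (hDual : PublishedDualityInputsAdditiveKoly)
    (h5 : 5 ≤ p) (hadd : Addv W p) (hsurj : W.HasSurjectiveModNGaloisRep p)
    (hsp : ∀ (ℓ : ℕ) [Fact ℓ.Prime], W.HasMultiplicativeReductionAtPrime ℓ →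
      ¬ p ∣ padicValInt ℓ W.minimalDiscriminantInt)
    (htwo : ∃ (ℓ₁ ℓ₂ : ℕ) (_ : Fact ℓ₁.Prime) (_ : Fact ℓ₂.Prime), ℓ₁ ≠ ℓ₂ ∧
      W.HasMultiplicativeReductionAtPrime ℓ₁ ∧ W.HasMultiplicativeReductionAtPrime ℓ₂)
    (htam : ¬ p ∣ W.tamagawaProduct) (hr : W.analyticRank = 1)
    (hK : IsImaginaryQuadratic K) (hodd : Odd (NumberField.discr K))
    (hH : SatisfiesHeegnerHypothesis (W.conductorNorm ℤ) K)
    (hL : (W.quadraticTwist (NumberField.discr K : ℚ)).entireLFunction 1 ≠ 0)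
    (hβ : (4 * (W.conductorNorm ℤ : ℤ)) ∣ β ^ 2 - NumberField.discr K) (hcM : ¬ (p : ℤ) ∣ Dt.c) :
    Odd (finrank (ZMod p) (SelQP W K p c ∅ true) + finrank (ZMod p) (SelQP W K p c ∅ false)) := by
  have hp : p.Prime := Fact.out
  have hp2 : p ≠ 2 := by omega
  obtain ⟨s, hsodd, hs⟩ := oddSelmerRankAdditive_of_levelInputs hPUB.1 hPUB.2.1 hPUB.2.2.2.2.1 hDual.1 W p K Dt β ι
    h5 hadd hsurj hsp htwo htam hr hK hodd hH hL hβ hcM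
  have e1 : ((p ^ 1 : ℕ) : ℤ) = (p : ℤ) := by simp
  have hs' : Nat.card (selmerGroup (W.baseChange K) ((p ^ 1 : ℕ) : ℤ)) = p ^ s := by rw [e1]; exact hs
  have hcard := natCard_selmer_eq_pow_finrank_selQP_add W K p hp2 hK c (Method2.algEquiv_mul_self_eq_one K hK c)
  rw [hs'] at hcard
  rwa [← Nat.pow_right_injective hp.two_le hcard]

/-! ## §2 KS′'s conclusion at a ♯ frame from a bipartite datum, ONE seed and (R′), granted PUB ∕ DUAL -/

/-- **KS′'s conclusion at a ♯ additive frame from a BIPARTITE datum, ONE SEED at a core level and witness-free ONE-PRIME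
RAISING (R′), granted the route's published inputs** — part 5's `nonempty_levelKolyvaginSystemP_of_bipartite_of_seed_at_frame`
with its parity binder discharged by `odd_finrank_selQP_empty_of_published`. Binders: the ♯ frame; `PublishedInputsAdditiveKoly`,
`PublishedDualityInputsAdditiveKoly` (BY NAME, the route's displayed published inputs); complex conjugation `c ≠ 1`; the
bipartite datum (even-level classes `κ₀` with the carrier's local axioms, odd-level values `λ`, laws (A) «`λ(m, n∪q) ≠ 0 ⟺
κ₀(m, n)` detected above `q`» and (B) «`κ₀(m, n'∪q)` detected above `q ⟺ λ(m, n') ≠ 0`» TWO-SIDED); `selmer_bottom` (`c(1)` is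
a signed Selmer class; vacuous when `c(1) ≡ 0`); ONE SEED at a level `n₀` of total canonical rank `≤ 1` (a non-zero
conductor-one class at even `n₀`, OR a unit value `λ(∅, n₀)` at odd `n₀`); (R′). Output: `Nonempty (LevelKolyvaginSystemP W K p
Dt β ι c)`. Compared with w2 g0's `nonempty_levelKolyvaginSystemP_of_bipartite_at_frame` the rank-0 ANCHOR (γ) AT EVERY ODD
LEVEL is replaced by ONE seed + (R′). CONDITIONAL; closes nothing; BSD is not proved by this.
[cite: Howard2006Bipartite, Prop. 2.4.11, Thm. 2.5.1] [cite: WZhang2014, Thm. 4.3, (4.8), Lemma 5.3, Prop. 5.4, Thm. 7.2,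
Lemma 7.3, Thm. 9.2, §9] [cite: BertoliniDarmon2005, Thm. 3.2, Thm. 4.1, Thm. 4.2] [cite: GrossLMS1991, §10] -/
theorem nonempty_levelKolyvaginSystemP_of_bipartite_of_seed_of_published (hPUB : PublishedInputsAdditiveKoly)
    (hDual : PublishedDualityInputsAdditiveKoly) (h5 : 5 ≤ p) (hadd : Addv W p) (hsurj : W.HasSurjectiveModNGaloisRep p)
    (hsp : ∀ (ℓ : ℕ) [Fact ℓ.Prime], W.HasMultiplicativeReductionAtPrime ℓ →
      ¬ p ∣ padicValInt ℓ W.minimalDiscriminantInt)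
    (htwo : ∃ (ℓ₁ ℓ₂ : ℕ) (_ : Fact ℓ₁.Prime) (_ : Fact ℓ₂.Prime), ℓ₁ ≠ ℓ₂ ∧
      W.HasMultiplicativeReductionAtPrime ℓ₁ ∧ W.HasMultiplicativeReductionAtPrime ℓ₂)
    (htam : ¬ p ∣ W.tamagawaProduct) (hr : W.analyticRank = 1)
    (hK : IsImaginaryQuadratic K) (hodd : Odd (NumberField.discr K))
    (hH : SatisfiesHeegnerHypothesis (W.conductorNorm ℤ) K)
    (hL : (W.quadraticTwist (NumberField.discr K : ℚ)).entireLFunction 1 ≠ 0)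
    (hβ : (4 * (W.conductorNorm ℤ : ℤ)) ∣ β ^ 2 - NumberField.discr K) (hcM : ¬ (p : ℤ) ∣ Dt.c) (hc1 : c ≠ 1)
    (ε₀ : Finset (AdmQ W K p) → Bool)
    (κ₀ : Finset {ℓ // Zhang2014.IsKolyvaginPrime (W.conductorNorm ℤ) W K p ℓ} → Finset (AdmQ W K p) → Vp W K p)
    (lam : Finset {ℓ // Zhang2014.IsKolyvaginPrime (W.conductorNorm ℤ) W K p ℓ} → Finset (AdmQ W K p) → ZMod p)
    (realisation : ∀ m : Finset {ℓ // Zhang2014.IsKolyvaginPrime (W.conductorNorm ℤ) W K p ℓ},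
      ∃ d : KolyvaginHeegnerData Dt β ι (∏ ℓ ∈ m, (ℓ : ℕ)), κ₀ m ∅ = d.kolyvaginClass (Fact.out : p.Prime) 1)
    (sign : ∀ n : Finset (AdmQ W K p), n.Nonempty → Even n.card →
      ∀ m : Finset {ℓ // Zhang2014.IsKolyvaginPrime (W.conductorNorm ℤ) W K p ℓ},
      conjAct W c ((p ^ 1 : ℕ) : ℤ) (κ₀ m n) = sgnP (ε₀ n ^^ Nat.bodd m.card) • κ₀ m n)
    (selmer_off : ∀ n : Finset (AdmQ W K p), n.Nonempty → Even n.card →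
      ∀ (m : Finset {ℓ // Zhang2014.IsKolyvaginPrime (W.conductorNorm ℤ) W K p ℓ}) (v : HeightOneSpectrum (𝓞 K)),
      (∀ ℓ ∈ m, ((ℓ : ℕ) : 𝓞 K) ∉ v.asIdeal) → (∀ q ∈ n, ((q : ℕ) : 𝓞 K) ∉ v.asIdeal) →
      κ₀ m n ∈ selmerLocalKer (W.baseChange K) (v.adicCompletion K) ((p ^ 1 : ℕ) : ℤ))
    (selmer_inf : ∀ n : Finset (AdmQ W K p), n.Nonempty → Even n.card →
      ∀ (m : Finset {ℓ // Zhang2014.IsKolyvaginPrime (W.conductorNorm ℤ) W K p ℓ}) (w : InfinitePlace K),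
      κ₀ m n ∈ selmerLocalKer (W.baseChange K) w.Completion ((p ^ 1 : ℕ) : ℤ))
    (toric_on : ∀ n : Finset (AdmQ W K p), n.Nonempty → Even n.card →
      ∀ m : Finset {ℓ // Zhang2014.IsKolyvaginPrime (W.conductorNorm ℤ) W K p ℓ}, ∀ q ∈ n,
      ∀ v : HeightOneSpectrum (𝓞 K),
      ((q : ℕ) : 𝓞 K) ∈ v.asIdeal → κ₀ m n ∈ toricLocalKer (W.baseChange K) (v.adicCompletion K) ((p ^ 1 : ℕ) : ℤ))
    (transverse_on : ∀ n : Finset (AdmQ W K p), n.Nonempty → Even n.card →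
      ∀ m : Finset {ℓ // Zhang2014.IsKolyvaginPrime (W.conductorNorm ℤ) W K p ℓ}, ∀ ℓ ∈ m,
      ∀ v : HeightOneSpectrum (𝓞 K),
      ((ℓ : ℕ) : 𝓞 K) ∈ v.asIdeal → κ₀ m n ∈ transverseLocalKerP W K p ι ℓ v)
    (relation : ∀ n : Finset (AdmQ W K p), n.Nonempty → Even n.card →
      ∀ (m : Finset {ℓ // Zhang2014.IsKolyvaginPrime (W.conductorNorm ℤ) W K p ℓ})
        (ℓ : {ℓ // Zhang2014.IsKolyvaginPrime (W.conductorNorm ℤ) W K p ℓ}), ℓ ∉ m → ∀ v : HeightOneSpectrum (𝓞 K),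
      ((ℓ : ℕ) : 𝓞 K) ∈ v.asIdeal →
      (κ₀ (insert ℓ m) n ∈ (W.baseChange K).torsionLocalKer (v.adicCompletion K) ((p ^ 1 : ℕ) : ℤ) ↔
        κ₀ m n ∈ (W.baseChange K).torsionLocalKer (v.adicCompletion K) ((p ^ 1 : ℕ) : ℤ)))
    (lawA : ∀ (n : Finset (AdmQ W K p)) (q : AdmQ W K p), Even n.card → q ∉ n →
      ∀ m : Finset {ℓ // Zhang2014.IsKolyvaginPrime (W.conductorNorm ℤ) W K p ℓ},
      lam m (insert q n) ≠ 0 ↔ ∃ v : HeightOneSpectrum (𝓞 K), ((q : ℕ) : 𝓞 K) ∈ v.asIdeal ∧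
        κ₀ m n ∉ (W.baseChange K).torsionLocalKer (v.adicCompletion K) ((p ^ 1 : ℕ) : ℤ))
    (lawB : ∀ (n : Finset (AdmQ W K p)) (q : AdmQ W K p), Odd n.card → q ∉ n →
      ∀ m : Finset {ℓ // Zhang2014.IsKolyvaginPrime (W.conductorNorm ℤ) W K p ℓ},
      (∃ v : HeightOneSpectrum (𝓞 K), ((q : ℕ) : 𝓞 K) ∈ v.asIdeal ∧
        κ₀ m (insert q n) ∉ (W.baseChange K).torsionLocalKer (v.adicCompletion K) ((p ^ 1 : ℕ) : ℤ)) ↔ lam m n ≠ 0)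
    (selmer_bottom : ∃ μ : Bool, κ₀ ∅ ∅ ∈ SelQP W K p c ∅ μ)
    (n₀ : Finset (AdmQ W K p))
    (hcore₀ : finrank (ZMod p) (SelQP W K p c n₀ true) + finrank (ZMod p) (SelQP W K p c n₀ false) ≤ 1)
    (seed : (Even n₀.card ∧ κ₀ ∅ n₀ ≠ 0) ∨ (Odd n₀.card ∧ lam ∅ n₀ ≠ 0))
    (hraise : ∀ (m : Finset (AdmQ W K p)) (q : AdmQ W K p) (μ : Bool), q ∉ m →
      (∀ v : HeightOneSpectrum (𝓞 K), ((q : ℕ) : 𝓞 K) ∈ v.asIdeal → ∀ z : Vp W K p,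
        (W.baseChange K).torsionLocMap (v.adicCompletion K) ((p ^ 1 : ℕ) : ℤ) (conjAct W c ((p ^ 1 : ℕ) : ℤ) z) =
          sgnP μ • (W.baseChange K).torsionLocMap (v.adicCompletion K) ((p ^ 1 : ℕ) : ℤ) z) →
      (∀ x ∈ SelQP W K p c m μ, ∀ v : HeightOneSpectrum (𝓞 K), ((q : ℕ) : 𝓞 K) ∈ v.asIdeal →
        x ∈ (W.baseChange K).torsionLocalKer (v.adicCompletion K) ((p ^ 1 : ℕ) : ℤ)) →
      SelQP W K p c m μ ≤ SelQP W K p c (insert q m) μ ∧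
        finrank (ZMod p) (SelQP W K p c (insert q m) μ) = finrank (ZMod p) (SelQP W K p c m μ) + 1) :
    Nonempty (LevelKolyvaginSystemP W K p Dt β ι c) :=
  nonempty_levelKolyvaginSystemP_of_bipartite_of_seed_at_frame W K p c Dt β ι h5 hadd hsurj hK hH hc1 ε₀ κ₀ lam
    realisation sign selmer_off selmer_inf toric_on transverse_on relation lawA lawB selmer_bottom n₀ hcore₀ seed hraise
    (odd_finrank_selQP_empty_of_published W K p c Dt β ι hPUB hDual h5 hadd hsurj hsp htwo htam hr hK hodd hH hL hβ hcM)

end Summit.BirchSwinnertonDyer.BirchSwinnertonDyer.Theorems.AdditiveKoly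

end
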